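/-
Copyright: public-domain mathematics; typed transcription for the H21 Literature library (cell lit-balaban,
Phase-2 proof seat p38 gen 7 = literature-prover-lit-balaban-p38-g7-0).

statement-level skeleton of published theorems with citation tags; proofs where landed; nothing here is a claim about the Yang–Mills mass gap

# Bałaban, *Propagators and renormalization transformations for lattice gauge theories. I*,
# Commun. Math. Phys. **95** (1984) 17–40 — the `L²(T_η)` CARRIER of the random walk (1.118)–(1.131) FOR THE OPERATOR
# `G = Δ_a⁻¹` OF RECORD: graded real `ℓ²` space, `G`, `Δ_a`, the multipliers `h_z`, the gradient norm, and (1.71)/(1.118)/(1.89)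
# read on it

[cite: Balaban1984PropagatorsI]  T. Bałaban, Commun. Math. Phys. 95 (1984) 17–40.  p. 30 (1.71) «Δ_a⁻¹ = G_k, or simply G»; p. 33
Prop. 1.1 «The operator G is a symmetric operator on L²(T_η) and ‖GJ‖, ‖∇GJ‖, ‖G∇*J‖, ‖∇G∇*J‖, ‖∇∇GJ‖, ‖G∇*∇*J‖ ≤ γ₀⁻¹‖J‖, (1.89)»;
p. 36 (1.118) «hence Σ_z h_z²(x) = 1»; p. 37 (1.121) «Δ_a hA = … = hΔ_aA − K(h)A»; p. 38 (1.128) «|h_{z₁}K(h_{z₂})A| ≤ O(M₀⁻¹)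
e^{−2δ₀|z₁−z₂|}(|∇A| + |A|)» (the norm `|∇A| + |A|` on the right).

WHAT THIS MODULE ADDS (SKELETON rows B5.Eq1.118–1.131 / B5.Prop1.2, owner r02; GAPS G-B5-03 = the printed random-walk route for
G; target: the record `B5Local114.Realisation` (pub-balaban B05 gen 4) for r02's setting of record `B5SettingP12Real.latticeSettingP12R`).
The abstract walk machine `B5Local114` wants ONE real inner-product space `V` carrying `G`, `Δ_a`, `∇`, `h_z` and the six entries
`ζ D₁ G D₂ J` of (1.114) as endomorphisms (`D₁ ∈ {1, ∇, ∇∇}`, `D₂ ∈ {1, ∇*, ∇*∇*}` change the tensor degree).  We take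
* §1 generic `ℓ²(ι)` facts (composition / identity / symmetry of the kernel operators `B5Commutator128.kerOp`);
* §2 THE GRADED CARRIER `Vsp n M = ℓ²((T_η × {1..d}) × Gr d)`, grades `Gr d = {0} ⊔ {1..d} ⊔ {1..d}²` (vector / 2-tensor /
  3-tensor fields), slices `sl f r`, the BLOCK-DIAGONAL lift `liftK T` of a real matrix on vector fields (same block on every grade)
  with `kerOp (liftK T) f = (T·(slice))` slicewise, `liftK T ∘ liftK T′ = liftK (TT′)`, `liftK 1 = 1`, and the slicewise norm bound
  `‖liftK T‖ ≤ c` from `‖T v‖ ≤ c‖v‖`;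
* §3 THE OPERATORS OF RECORD on it: `Gop = liftK G`, `DAop = liftK Δ_a` with pub-balaban pv15's REAL matrices `B5RealFields.GR/DeltaAR`
  (= `re` of r02's `(DeltaA n M a)⁻¹`, `DeltaA n M a`): (1.71) `Δ_aG = GΔ_a = 1` (`DAop_mul_Gop`, `Gop_mul_DAop`), symmetry of `G`
  (`Gop_symm`, «G is a symmetric operator on L²(T_η)»); the multipliers `Hop z = h_z` by the scale-`M₀` partition of
  `B5WalkPartitionTorus` with (1.118) `Σ_z HopHop = 1` (`h118_Hop`) and symmetry;
* §4 THE GRADIENT NORM: `gradL f = (∇_ν f_r)_{r,ν}` slicewise (r02/pv15's `fdiffR`), and an endomorphism `Dg` of `Vsp` with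
  `‖Dg f‖ = ‖gradL f‖` EXACTLY (`norm_Dg`; `Dg = U ∘ ∇` for an isometric re-embedding `U` of `range ∇` into `Vsp` — the abstract
  machine only ever reads `‖Dg ·‖`, i.e. `|∇A|` of (1.128)); `‖Dg (liftK T f)‖ ≤ c‖f‖` from `‖∇(Tv)‖ ≤ c‖v‖` slicewise;
* §5 (1.89) READ ON THE CARRIER: the field `h89` of `B5Local114.Realisation` — from the abstract Prop-1.1 clause of
  `latticeSettingP12R n M a k` (its members ‖GJ‖, ‖∇GJ‖ at real vector sources) follow `‖Gop B‖ ≤ γ₀⁻¹‖B‖`, `‖Dg (Gop B)‖ ≤ γ₀⁻¹‖B‖`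
  on ALL of `Vsp` (`h89_holds`), via pv15's complexification dictionary `cplx_GR_mulVec`, `cplx_gradR`, `l2R_eq`, `l2TR_eq`.

HONEST SCOPE.  Bookkeeping over finite-dimensional `ℓ²`; the analytic inputs are r02/pv15's typed operators and theorems, cited by
name; no estimate of the paper is proved here beyond transporting (1.89) to the carrier.  The printed weight `η^{d/2}` of
`L²(T_η)` is carried by the source embedding (companion module `B5WalkEntriesTorus`), both sides of every inequality scaling alike.
value = the carrier half of the located leaves of `B5Local114.Realisation` for the torus of record — NOT summit progress.
-/
import Mathlib
import Literature.MathematicalPhysics.QuantumFieldTheory.Balaban1983to89.B5Leibniz121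
import Literature.MathematicalPhysics.QuantumFieldTheory.Balaban1983to89.B5RealFields
import Literature.MathematicalPhysics.QuantumFieldTheory.Balaban1983to89.B5SettingP12Real
import Literature.MathematicalPhysics.QuantumFieldTheory.Balaban1983to89.B5WalkPartitionTorus

open scoped BigOperators Real Matrix
open Finset Matrix

namespace Literature.MathematicalPhysics.QuantumFieldTheory.Balaban1983to89.B5WalkCarrierTorus

open Literature.MathematicalPhysics.QuantumFieldTheory.Balaban1983to89
open Literature.MathematicalPhysics.QuantumFieldTheory.Balaban1983to89.B5Prop11Plancherel (Tor fine)
open Literature.MathematicalPhysics.QuantumFieldTheory.Balaban1983to89.B5Prop11Lattice (l2 l2T grad)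
open Literature.MathematicalPhysics.QuantumFieldTheory.Balaban1983to89.B5Prop11SettingModel (Loc189 locNorm l2op189)
open Literature.MathematicalPhysics.QuantumFieldTheory.Balaban1983to89.B5Commutator128 (kerOp kerOp_apply)
open Literature.MathematicalPhysics.QuantumFieldTheory.Balaban1983to89.B5TorusPartition (mulOp mulOp_apply mulOp_mul sum_mulOp_mul_self
  inner_mulOp_left norm_mulOp_le)
open Literature.MathematicalPhysics.QuantumFieldTheory.Balaban1983to89.B5RealFields (GR DeltaAR fdiffR l2R l2TR gradR cplx reM
  l2R_eq l2TR_eq l2R_nonneg cplx_GR_mulVec cplx_gradR)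
open Literature.MathematicalPhysics.QuantumFieldTheory.Balaban1983to89.B5SettingP12Weighted (sqEta etaPow sqEta_nonneg sqEta_sq)
open Literature.MathematicalPhysics.QuantumFieldTheory.Balaban1983to89.B5SettingP12Real (LocR latticeSettingP12R)
open Literature.MathematicalPhysics.QuantumFieldTheory.Balaban1983to89.B5WalkTorusGeom (TorR ucPt Cen)
open Literature.MathematicalPhysics.QuantumFieldTheory.Balaban1983to89.B5WalkPartitionTorus (hz hz_nonneg hz_le_one abs_hz_le_one sum_hz_sq)

noncomputable section

/-! ## §1 Generic facts about kernel operators on `ℓ²(ι)` -/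

section Generic

variable {ι : Type} [Fintype ι]

/-- `‖f‖² = Σ_i f_i²` on `ℓ²(ι)`. [cite: Balaban1984PropagatorsI, Prop. 1.1 p.33 (L²(T_η))] -/
theorem normSq_eq (f : EuclideanSpace ℝ ι) : ‖f‖ ^ 2 = ∑ i, f i ^ 2 := by
  rw [PiLp.norm_sq_eq_of_L2]
  exact Finset.sum_congr rfl fun i _ => by rw [Real.norm_eq_abs, sq_abs]

/-- composition of kernel operators is the kernel operator of the matrix product. [cite: Balaban1984PropagatorsI, (1.71) p.30 (Δ_aG = 1 as operators)] -/
theorem kerOp_mul_kerOp (k k' : ι → ι → ℝ) :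
    kerOp k * kerOp k' = kerOp fun i j => ∑ m, k i m * k' m j := by
  apply LinearMap.ext
  intro v
  ext i
  simp only [Module.End.mul_apply, kerOp_apply, Finset.mul_sum, Finset.sum_mul, mul_assoc]
  rw [Finset.sum_comm]

/-- the Kronecker kernel is the identity operator. [cite: Balaban1984PropagatorsI, (1.71) p.30] -/
theorem kerOp_delta [DecidableEq ι] : kerOp (fun i j : ι => if i = j then (1 : ℝ) else 0) = 1 := by
  apply LinearMap.ext
  intro v
  ext i
  simp only [kerOp_apply, ite_mul, one_mul, zero_mul, Finset.sum_ite_eq, Finset.mem_univ, if_true, Module.End.one_apply]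

/-- the adjoint of a kernel operator is the kernel operator of the transposed kernel.
[cite: Balaban1984PropagatorsI, Prop. 1.1 p.33 («G is a symmetric operator»), p.39 («a representation of G adjoint to (1.123)»)] -/
theorem inner_kerOp_left (k : ι → ι → ℝ) (u v : EuclideanSpace ℝ ι) :
    inner ℝ (kerOp k u) v = inner ℝ u (kerOp (fun i j => k j i) v) := by
  simp only [PiLp.inner_apply, kerOp_apply, RCLike.inner_apply, conj_trivial]
  simp only [Finset.mul_sum, Finset.sum_mul]
  rw [Finset.sum_comm]
  exact Finset.sum_congr rfl fun i _ => Finset.sum_congr rfl fun j _ => by ring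

/-- a kernel operator with symmetric kernel is a symmetric operator. [cite: Balaban1984PropagatorsI, Prop. 1.1 p.33] -/
theorem inner_kerOp_symm {k : ι → ι → ℝ} (hk : ∀ i j, k i j = k j i) (u v : EuclideanSpace ℝ ι) :
    inner ℝ (kerOp k u) v = inner ℝ u (kerOp k v) := by
  rw [inner_kerOp_left]
  congr 2
  apply LinearMap.ext; intro w; ext i
  simp only [kerOp_apply, hk]

end Generic

/-! ## §2 The graded carrier, slices and block-diagonal lifts -/

section Carrier

variable {d : ℕ} (n : ℕ) [NeZero n] (M : Fin d → ℕ) [hM : ∀ μ, NeZero (M μ)]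

omit hM in
/-- **the grades**: `0` = vector fields (the arguments of `G`, `∇G`, `∇∇G` and all values of the walk), `1..d` = 2-tensor fields
`(J_ν)_ν` (arguments of `G∇*`, values of `∇`), `(1..d)²` = 3-tensor fields (arguments of `G∇*∇*`, values of `∇∇`).
[cite: Balaban1984PropagatorsI, Prop. 1.1 (1.89) p.33, Prop. 1.2 (1.114) p.36] -/
abbrev Gr (d : ℕ) : Type := Unit ⊕ (Fin d ⊕ (Fin d × Fin d))

/-- the bond indices `(x, μ)` of a vector field on `T_η`. [cite: Balaban1984PropagatorsI, (1.1) p.18] -/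
abbrev Bnd : Type := Tor (fine n M) × Fin d

/-- the index set of the graded carrier. [cite: Balaban1984PropagatorsI, Prop. 1.2 (1.114) p.36] -/
abbrev Idx : Type := Bnd n M × Gr d

/-- **THE CARRIER `V = ⊕_{grades} ℓ²(T_η × {1..d})`** (real; the `V` of `B5Local114.Realisation`).
[cite: Balaban1984PropagatorsI, Prop. 1.1 p.33 (L²(T_η))] -/
abbrev Vsp : Type := EuclideanSpace ℝ (Idx n M)

variable {n M}

/-- the slice of grade `r`: a real vector field on `T_η`. [cite: Balaban1984PropagatorsI, Prop. 1.1 p.33] -/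
def sl (f : Vsp n M) (r : Gr d) : Bnd n M → ℝ := fun b => f (b, r)

omit [NeZero n] hM in
/-- `sl` unfolds. [cite: Balaban1984PropagatorsI, Prop. 1.1 p.33] -/
@[simp] theorem sl_apply (f : Vsp n M) (r : Gr d) (b : Bnd n M) : sl f r b = f (b, r) := rfl

/-- **`‖f‖² = Σ_r Σ_b f(b,r)²`**: the carrier norm is the `ℓ²` sum of the slice norms. [cite: Balaban1984PropagatorsI, Prop. 1.1 p.33] -/
theorem normSq_eq_sum_sl (f : Vsp n M) : ‖f‖ ^ 2 = ∑ r : Gr d, ∑ b : Bnd n M, sl f r b ^ 2 := by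
  rw [normSq_eq, Fintype.sum_prod_type, Finset.sum_comm]
  rfl

/-- `l2R u² = Σ u²`. [cite: Balaban1984PropagatorsI, Prop. 1.1 p.33] -/
theorem l2R_sq {m : Type*} [Fintype m] (u : m → ℝ) : l2R u ^ 2 = ∑ i, u i ^ 2 :=
  Real.sq_sqrt (Finset.sum_nonneg fun _ _ => sq_nonneg _)

/-- `l2TR F² = Σ_s Σ F²`. [cite: Balaban1984PropagatorsI, Prop. 1.1 p.33] -/
theorem l2TR_sq {m S : Type*} [Fintype m] [Fintype S] (F : S → m → ℝ) : l2TR F ^ 2 = ∑ s, ∑ i, F s i ^ 2 :=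
  Real.sq_sqrt (Finset.sum_nonneg fun _ _ => Finset.sum_nonneg fun _ _ => sq_nonneg _)

/-- `‖f‖² = Σ_r ‖slice_r‖²`. [cite: Balaban1984PropagatorsI, Prop. 1.1 p.33] -/
theorem normSq_eq_sum_l2R_sq (f : Vsp n M) : ‖f‖ ^ 2 = ∑ r : Gr d, l2R (sl f r) ^ 2 := by
  rw [normSq_eq_sum_sl]
  exact Finset.sum_congr rfl fun r _ => (l2R_sq _).symm

variable (n M)

/-- **the block-diagonal lift** of a real matrix on vector fields: the same block on every grade, zero between grades.
[cite: Balaban1984PropagatorsI, (1.123) p.37 (G, h_z, K(h_z) act on vector functions)] -/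
def liftK (T : Matrix (Bnd n M) (Bnd n M) ℝ) : Idx n M → Idx n M → ℝ := fun p q => if p.2 = q.2 then T p.1 q.1 else 0

omit [NeZero n] hM in
/-- `liftK` unfolds. [cite: Balaban1984PropagatorsI, (1.123) p.37] -/
theorem liftK_apply (T : Matrix (Bnd n M) (Bnd n M) ℝ) (p q : Idx n M) :
    liftK n M T p q = if p.2 = q.2 then T p.1 q.1 else 0 := rfl

/-- **the lift acts slicewise**: `(liftK T f)(b, r) = (T · f_r)(b)`. [cite: Balaban1984PropagatorsI, (1.123) p.37] -/
theorem kerOp_liftK_apply (T : Matrix (Bnd n M) (Bnd n M) ℝ) (f : Vsp n M) (p : Idx n M) :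
    kerOp (liftK n M T) f p = (T *ᵥ sl f p.2) p.1 := by
  rw [kerOp_apply, Fintype.sum_prod_type, Matrix.mulVec, dotProduct]
  refine Finset.sum_congr rfl fun b _ => ?_
  simp only [liftK_apply, ite_mul, zero_mul]
  rw [Finset.sum_ite_eq Finset.univ p.2]
  simp [sl]

/-- slices of a lifted operator. [cite: Balaban1984PropagatorsI, (1.123) p.37] -/
theorem sl_kerOp_liftK (T : Matrix (Bnd n M) (Bnd n M) ℝ) (f : Vsp n M) (r : Gr d) :
    sl (kerOp (liftK n M T) f) r = T *ᵥ sl f r := by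
  funext b
  exact kerOp_liftK_apply n M T f (b, r)

/-- **lifting is multiplicative**: `liftK T ∘ liftK T′ = liftK (TT′)`. [cite: Balaban1984PropagatorsI, (1.71) p.30] -/
theorem kerOp_liftK_mul (T T' : Matrix (Bnd n M) (Bnd n M) ℝ) :
    kerOp (liftK n M T) * kerOp (liftK n M T') = kerOp (liftK n M (T * T')) := by
  rw [kerOp_mul_kerOp]
  congr 1
  funext p q
  rw [Fintype.sum_prod_type]
  simp only [liftK_apply, Matrix.mul_apply]
  by_cases h : p.2 = q.2
  · rw [if_pos h]
    refine Finset.sum_congr rfl fun b _ => ?_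
    rw [Finset.sum_eq_single p.2]
    · simp [h]
    · intro r _ hr
      rw [if_neg (Ne.symm hr), zero_mul]
    · intro hp; exact absurd (Finset.mem_univ _) hp
  · rw [if_neg h]
    refine Finset.sum_eq_zero fun b _ => Finset.sum_eq_zero fun r _ => ?_
    by_cases h1 : p.2 = r
    · subst h1; rw [if_neg h, mul_zero]
    · rw [if_neg h1, zero_mul]

/-- **lifting the identity gives the identity**. [cite: Balaban1984PropagatorsI, (1.71) p.30] -/
theorem kerOp_liftK_one : kerOp (liftK n M (1 : Matrix (Bnd n M) (Bnd n M) ℝ)) = 1 := by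
  rw [← kerOp_delta]
  congr 1
  funext p q
  simp only [liftK_apply, Matrix.one_apply]
  by_cases h : p = q
  · subst h; simp
  · rw [if_neg h]
    by_cases h2 : p.2 = q.2
    · rw [if_pos h2, if_neg]
      intro h1
      exact h (Prod.ext h1 h2)
    · rw [if_neg h2]

omit [NeZero n] hM in
/-- a symmetric block lifts to a symmetric kernel. [cite: Balaban1984PropagatorsI, Prop. 1.1 p.33] -/
theorem liftK_symm {T : Matrix (Bnd n M) (Bnd n M) ℝ} (hT : Tᵀ = T) (p q : Idx n M) :
    liftK n M T p q = liftK n M T q p := by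
  simp only [liftK_apply]
  by_cases h : p.2 = q.2
  · rw [if_pos h, if_pos h.symm, ← hT, Matrix.transpose_apply, hT]
  · rw [if_neg h, if_neg (Ne.symm h)]

omit [NeZero n] hM in
/-- **lifting is additive**. [cite: Balaban1984PropagatorsI, (1.69) p.29 (Δ_a as a sum)] -/
theorem liftK_add (T T' : Matrix (Bnd n M) (Bnd n M) ℝ) :
    liftK n M (T + T') = fun p q => liftK n M T p q + liftK n M T' p q := by
  funext p q
  simp only [liftK_apply, Matrix.add_apply]
  split_ifs <;> simp

/-- **slicewise operator bounds lift**: if `‖Tv‖ ≤ c‖v‖` for every real vector field `v` (`c ≥ 0`), then `‖liftK T f‖ ≤ c‖f‖` on the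
graded carrier. [cite: Balaban1984PropagatorsI, Prop. 1.1 (1.89) p.33] -/
theorem norm_kerOp_liftK_le {T : Matrix (Bnd n M) (Bnd n M) ℝ} {c : ℝ} (hc : 0 ≤ c)
    (hT : ∀ v : Bnd n M → ℝ, l2R (T *ᵥ v) ≤ c * l2R v) (f : Vsp n M) :
    ‖kerOp (liftK n M T) f‖ ≤ c * ‖f‖ := by
  have h2 : ‖kerOp (liftK n M T) f‖ ^ 2 ≤ (c * ‖f‖) ^ 2 := by
    rw [normSq_eq_sum_l2R_sq, mul_pow, normSq_eq_sum_l2R_sq, Finset.mul_sum]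
    refine Finset.sum_le_sum fun r _ => ?_
    rw [sl_kerOp_liftK, ← mul_pow]
    exact pow_le_pow_left₀ (l2R_nonneg _) (hT _) 2
  exact pow_le_pow_iff_left₀ (norm_nonneg _) (mul_nonneg hc (norm_nonneg _)) two_ne_zero |>.mp h2

end Carrier

/-! ## §3 The operators of record on the carrier: `G`, `Δ_a` ((1.71)), the multipliers `h_z` ((1.118)) -/

section Operators

variable {d : ℕ} (n : ℕ) [NeZero n] (M : Fin d → ℕ) [hM : ∀ μ, NeZero (M μ)] (a : ℝ)

/-- **`G = Δ_a⁻¹` on the graded carrier** (slicewise pv15's real matrix `GR = re((DeltaA n M a)⁻¹)`).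
[cite: Balaban1984PropagatorsI, (1.71) p.30 («Δ_a⁻¹ = G_k, or simply G»)] -/
def Gop : Module.End ℝ (Vsp n M) := kerOp (liftK n M (GR n M a))

/-- **`Δ_a` on the graded carrier** (slicewise `DeltaAR = re(DeltaA n M a)`, r02's `Δ − ∂P∂* + aQ*Q`).
[cite: Balaban1984PropagatorsI, (1.69) p.29, (1.73) p.30] -/
def DAop : Module.End ℝ (Vsp n M) := kerOp (liftK n M (DeltaAR n M a))

variable {n M a}

/-- **(1.71) `Δ_a G = 1`** on the carrier. [cite: Balaban1984PropagatorsI, (1.71) p.30] -/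
theorem DAop_mul_Gop (hn : 1 ≤ n) (ha : 0 < a) : DAop n M a * Gop n M a = 1 := by
  rw [DAop, Gop, kerOp_liftK_mul, B5RealFields.DeltaAR_mul_GR n hn M a ha, kerOp_liftK_one]

/-- **(1.71) `G Δ_a = 1`** on the carrier. [cite: Balaban1984PropagatorsI, (1.71) p.30] -/
theorem Gop_mul_DAop (hn : 1 ≤ n) (ha : 0 < a) : Gop n M a * DAop n M a = 1 := by
  rw [DAop, Gop, kerOp_liftK_mul, B5RealFields.GR_mul_DeltaAR n hn M a ha, kerOp_liftK_one]

/-- **«The operator G is a symmetric operator on L²(T_η)»** on the carrier. [cite: Balaban1984PropagatorsI, Prop. 1.1 p.33] -/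
theorem Gop_symm (hn : 1 ≤ n) (ha : 0 < a) (u v : Vsp n M) : inner ℝ (Gop n M a u) v = inner ℝ u (Gop n M a v) :=
  inner_kerOp_symm (liftK_symm n M (B5RealFields.GR_transpose n hn M a ha)) u v

/-- pointwise action of `G`: slicewise `GR`. [cite: Balaban1984PropagatorsI, (1.71) p.30] -/
theorem Gop_apply (f : Vsp n M) (p : Idx n M) : Gop n M a f p = (GR n M a *ᵥ sl f p.2) p.1 := kerOp_liftK_apply n M _ f p

/-- slices of `G f`. [cite: Balaban1984PropagatorsI, (1.71) p.30] -/
theorem sl_Gop (f : Vsp n M) (r : Gr d) : sl (Gop n M a f) r = GR n M a *ᵥ sl f r := sl_kerOp_liftK n M _ f r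

variable (n M) (M₀ : ℕ)

/-- the coefficient function of the multiplier `h_z` on the graded index set (constant in the component and the grade).
[cite: Balaban1984PropagatorsI, (1.118) p.36] -/
def hcoef (z : Cen M M₀) : Idx n M → ℝ := fun p => hz M M₀ z (ucPt M n p.1.1)

/-- **the multiplier `h_z`** on the carrier. [cite: Balaban1984PropagatorsI, (1.118)–(1.119) p.36] -/
def Hop (z : Cen M M₀) : Module.End ℝ (Vsp n M) := mulOp (hcoef n M M₀ z)

variable {n M M₀}

omit [NeZero n] hM in
/-- `Hop` unfolds. [cite: Balaban1984PropagatorsI, (1.118) p.36] -/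
theorem Hop_eq (z : Cen M M₀) : Hop n M M₀ z = mulOp (hcoef n M M₀ z) := rfl

omit [NeZero n] hM in
/-- pointwise action of `h_z`. [cite: Balaban1984PropagatorsI, (1.118) p.36] -/
theorem Hop_apply (z : Cen M M₀) (f : Vsp n M) (p : Idx n M) : Hop n M M₀ z f p = hz M M₀ z (ucPt M n p.1.1) * f p := rfl

omit [NeZero n] hM in
/-- `|h_z| ≤ 1` on the index set. [cite: Balaban1984PropagatorsI, (1.118) p.36] -/
theorem abs_hcoef_le_one (z : Cen M M₀) (p : Idx n M) : |hcoef n M M₀ z p| ≤ 1 := abs_hz_le_one M M₀ z _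

omit [NeZero n] hM in
/-- **(1.118) `Σ_z h_z h_z = 1`** on the carrier — the field `h118` of `B5Local114.Realisation`.
[cite: Balaban1984PropagatorsI, (1.118) p.36 («hence Σ_z h_z²(x) = 1»)] -/
theorem h118_Hop : ∑ z : Cen M M₀, Hop n M M₀ z * Hop n M M₀ z = 1 :=
  sum_mulOp_mul_self (hcoef n M M₀) fun p => sum_hz_sq M M₀ (ucPt M n p.1.1)

/-- the multipliers are symmetric — the field `symmH`. [cite: Balaban1984PropagatorsI, (1.118) p.36] -/
theorem Hop_symm (z : Cen M M₀) (u v : Vsp n M) : inner ℝ (Hop n M M₀ z u) v = inner ℝ u (Hop n M M₀ z v) :=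
  inner_mulOp_left _ u v

/-- `‖h_z f‖ ≤ ‖f‖`. [cite: Balaban1984PropagatorsI, (1.118) p.36] -/
theorem norm_Hop_le (z : Cen M M₀) (f : Vsp n M) : ‖Hop n M M₀ z f‖ ≤ ‖f‖ := by
  have h := norm_mulOp_le (a := hcoef n M M₀ z) zero_le_one (abs_hcoef_le_one z) f
  rwa [one_mul] at h

end Operators

/-! ## §4 The gradient norm `|∇A|` of (1.128) as an endomorphism of the carrier -/

section Gradient

variable {d : ℕ} (n : ℕ) [NeZero n] (M : Fin d → ℕ) [hM : ∀ μ, NeZero (M μ)]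

/-- **the graded gradient `(∇_ν f_r)_{(r,ν)}`** (pv15's real difference matrices `fdiffR ν = re(fdiff)`, lattice factor `η⁻¹`),
valued in `ℓ²(Idx × {1..d})`. [cite: Balaban1984PropagatorsI, (1.31) p.23, (1.128) p.38 (|∇A|)] -/
def gradL : Vsp n M →ₗ[ℝ] EuclideanSpace ℝ (Idx n M × Fin d) where
  toFun f := WithLp.toLp 2 fun q => (fdiffR n M q.2 *ᵥ sl f q.1.2) q.1.1
  map_add' f g := by
    ext q
    simp only [PiLp.add_apply]
    have : sl (f + g) q.1.2 = sl f q.1.2 + sl g q.1.2 := by funext b; simp [sl]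
    rw [this, Matrix.mulVec_add, Pi.add_apply]
  map_smul' c f := by
    ext q
    simp only [PiLp.smul_apply, smul_eq_mul, RingHom.id_apply]
    have : sl (c • f) q.1.2 = c • sl f q.1.2 := by funext b; simp [sl]
    rw [this, Matrix.mulVec_smul, Pi.smul_apply, smul_eq_mul]

variable {n M}

/-- `gradL` unfolds. [cite: Balaban1984PropagatorsI, (1.31) p.23] -/
theorem gradL_apply (f : Vsp n M) (q : Idx n M × Fin d) : gradL n M f q = (fdiffR n M q.2 *ᵥ sl f q.1.2) q.1.1 := rfl

/-- **`‖∇f‖² = Σ_r ‖∇(f_r)‖²`** (pv15's tensor norm `l2TR (gradR ·)` slicewise). [cite: Balaban1984PropagatorsI, (1.89) p.33 (‖∇GJ‖)] -/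
theorem normSq_gradL (f : Vsp n M) : ‖gradL n M f‖ ^ 2 = ∑ r : Gr d, l2TR (gradR n M (sl f r)) ^ 2 := by
  rw [normSq_eq, Fintype.sum_prod_type, Fintype.sum_prod_type, Finset.sum_comm]
  refine Finset.sum_congr rfl fun r _ => ?_
  rw [l2TR_sq, Finset.sum_comm]
  rfl

/-! ### an isometric re-embedding of `range ∇` into the carrier -/

section Iso

variable {ι κ : Type} [Fintype ι] [Fintype κ] [DecidableEq κ]

/-- extension by zero along an injection of index sets. [cite: Balaban1984PropagatorsI, (1.128) p.38 (the norm |∇A| + |A| lives on one space)] -/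
def extZ (e : ι ↪ κ) : EuclideanSpace ℝ ι →ₗ[ℝ] EuclideanSpace ℝ κ where
  toFun v := WithLp.toLp 2 fun j => ∑ i, if e i = j then v i else 0
  map_add' u v := by
    ext j
    simp only [PiLp.add_apply, ← Finset.sum_add_distrib]
    exact Finset.sum_congr rfl fun i _ => by split_ifs <;> simp
  map_smul' c v := by
    ext j
    simp only [PiLp.smul_apply, smul_eq_mul, RingHom.id_apply, Finset.mul_sum]
    exact Finset.sum_congr rfl fun i _ => by split_ifs <;> simp

omit [Fintype κ] in
/-- values on the image. [cite: Balaban1984PropagatorsI, (1.128) p.38] -/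
theorem extZ_apply_self (e : ι ↪ κ) (v : EuclideanSpace ℝ ι) (i : ι) : extZ e v (e i) = v i := by
  show (∑ i', if e i' = e i then v i' else 0) = v i
  rw [Finset.sum_eq_single i (fun j _ hj => if_neg fun h => hj (e.injective h)) (fun h => absurd (Finset.mem_univ i) h),
    if_pos rfl]

omit [Fintype κ] in
/-- values off the image vanish. [cite: Balaban1984PropagatorsI, (1.128) p.38] -/
theorem extZ_apply_of_forall_ne (e : ι ↪ κ) (v : EuclideanSpace ℝ ι) {j : κ} (hj : ∀ i, e i ≠ j) : extZ e v j = 0 := by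
  show (∑ i', if e i' = j then v i' else 0) = 0
  exact Finset.sum_eq_zero fun i _ => if_neg (hj i)

/-- **extension by zero is isometric**. [cite: Balaban1984PropagatorsI, (1.128) p.38] -/
theorem norm_extZ (e : ι ↪ κ) (v : EuclideanSpace ℝ ι) : ‖extZ e v‖ = ‖v‖ := by
  have h2 : ‖extZ e v‖ ^ 2 = ‖v‖ ^ 2 := by
    rw [normSq_eq, normSq_eq]
    rw [← Finset.sum_subset (Finset.subset_univ (Finset.univ.map e))
      (fun j _ hj => by
        rw [extZ_apply_of_forall_ne e v (fun i hi => hj (Finset.mem_map.mpr ⟨i, Finset.mem_univ _, hi⟩)), zero_pow two_ne_zero])]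
    rw [Finset.sum_map]
    exact Finset.sum_congr rfl fun i _ => by rw [extZ_apply_self]
  exact (pow_left_inj₀ (norm_nonneg _) (norm_nonneg _) two_ne_zero).mp h2

end Iso

variable (n M)

/-- the dimension of `range ∇` is at most the dimension of the carrier. [cite: Balaban1984PropagatorsI, (1.128) p.38] -/
theorem finrank_range_gradL_le : Module.finrank ℝ (LinearMap.range (gradL n M)) ≤ Fintype.card (Idx n M) := by
  have h := LinearMap.finrank_range_le (gradL n M)
  rwa [finrank_euclideanSpace] at h

/-- an injection of a standard index set of `range ∇` into the index set of the carrier. [cite: Balaban1984PropagatorsI, (1.128) p.38] -/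
def embIdx : Fin (Module.finrank ℝ (LinearMap.range (gradL n M))) ↪ Idx n M :=
  (Fin.castLEEmb (finrank_range_gradL_le n M)).trans (Fintype.equivFin (Idx n M)).symm.toEmbedding

/-- **`Dg = U ∘ ∇`**: the graded gradient followed by an isometric re-embedding of its range into the carrier (orthonormal coordinates of
`range ∇`, then extension by zero) — an endomorphism of the carrier with `‖Dg f‖ = ‖∇f‖`, which is all the walk machine reads («|∇A|»
in (1.128)). [cite: Balaban1984PropagatorsI, (1.128) p.38] -/
def Dg : Module.End ℝ (Vsp n M) :=
  (extZ (embIdx n M)) ∘ₗ (stdOrthonormalBasis ℝ (LinearMap.range (gradL n M))).repr.toLinearIsometry.toLinearMap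
    ∘ₗ (gradL n M).rangeRestrict

variable {n M}

/-- **`‖Dg f‖ = ‖∇f‖`**. [cite: Balaban1984PropagatorsI, (1.128) p.38 (|∇A|)] -/
theorem norm_Dg (f : Vsp n M) : ‖Dg n M f‖ = ‖gradL n M f‖ := by
  unfold Dg
  simp only [LinearMap.coe_comp, Function.comp_apply]
  rw [norm_extZ, LinearIsometry.coe_toLinearMap, LinearIsometry.norm_map]
  rfl

/-- `‖Dg f‖² = Σ_r ‖∇ f_r‖²`. [cite: Balaban1984PropagatorsI, (1.128) p.38] -/
theorem normSq_Dg (f : Vsp n M) : ‖Dg n M f‖ ^ 2 = ∑ r : Gr d, l2TR (gradR n M (sl f r)) ^ 2 := by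
  rw [norm_Dg, normSq_gradL]

variable (n M)

/-- **slicewise gradient bounds lift**: if `‖∇(Tv)‖ ≤ c‖v‖` for every real vector field `v` (`c ≥ 0`), then `‖Dg (liftK T f)‖ ≤ c‖f‖`.
[cite: Balaban1984PropagatorsI, Prop. 1.1 (1.89) p.33 (‖∇GJ‖)] -/
theorem norm_Dg_kerOp_liftK_le {T : Matrix (Bnd n M) (Bnd n M) ℝ} {c : ℝ} (hc : 0 ≤ c)
    (hT : ∀ v : Bnd n M → ℝ, l2TR (gradR n M (T *ᵥ v)) ≤ c * l2R v) (f : Vsp n M) :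
    ‖Dg n M (kerOp (liftK n M T) f)‖ ≤ c * ‖f‖ := by
  have h2 : ‖Dg n M (kerOp (liftK n M T) f)‖ ^ 2 ≤ (c * ‖f‖) ^ 2 := by
    rw [normSq_Dg, mul_pow, normSq_eq_sum_l2R_sq, Finset.mul_sum]
    refine Finset.sum_le_sum fun r _ => ?_
    rw [sl_kerOp_liftK, ← mul_pow]
    exact pow_le_pow_left₀ (Real.sqrt_nonneg _) (hT _) 2
  exact pow_le_pow_iff_left₀ (norm_nonneg _) (mul_nonneg hc (norm_nonneg _)) two_ne_zero |>.mp h2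

end Gradient

/-! ## §5 (1.89) read on the carrier: the field `h89` of `B5Local114.Realisation` -/

section H89

variable {d : ℕ} (n : ℕ) [NeZero n] (M : Fin d → ℕ) [hM : ∀ μ, NeZero (M μ)] (a : ℝ) (k : ℕ)

omit [NeZero n] in
/-- `η^{d/2} > 0`. [cite: Balaban1984PropagatorsI, (1.21) p.21] -/
theorem sqEta_pos (hn : 1 ≤ n) : 0 < sqEta n d := by
  unfold sqEta etaPow
  apply Real.sqrt_pos.mpr
  have : (0 : ℝ) < (n : ℝ)⁻¹ := by
    have : (0 : ℝ) < n := by exact_mod_cast hn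
    positivity
  positivity

variable {n M a k}

/-- the Prop-1.1 clause of the setting of record at a real VECTOR source, member `‖GJ‖`: `‖G v‖ ≤ γ₀⁻¹‖v‖` in pv15's real norms.
[cite: Balaban1984PropagatorsI, Prop. 1.1 (1.89) p.33 (‖GJ‖ ≤ γ₀⁻¹‖J‖)] -/
theorem l2R_GR_le_of_clause (hn : 1 ≤ n) {γ₀ : ℝ}
    (hcl : ∀ (m : Fin 6) (J : LocR n M), (latticeSettingP12R n M a k).l2op m J ≤ γ₀⁻¹ * (latticeSettingP12R n M a k).l2Norm J)
    (v : Bnd n M → ℝ) : l2R (GR n M a *ᵥ v) ≤ γ₀⁻¹ * l2R v := by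
  have h := hcl 0 (LocR.vec v)
  change sqEta n d * l2op189 n M a 0 (Loc189.vec (cplx v)) ≤ γ₀⁻¹ * (sqEta n d * locNorm (Loc189.vec (cplx v))) at h
  rw [B5Prop11SettingModel.l2op189_zero_vec] at h
  change sqEta n d * l2 ((B5DeltaA169.DeltaA n M a)⁻¹ *ᵥ cplx v) ≤ γ₀⁻¹ * (sqEta n d * l2 (cplx v)) at h
  rw [← cplx_GR_mulVec n M a v, ← l2R_eq, ← l2R_eq] at h
  have hs := sqEta_pos n hn (d := d)
  nlinarith

/-- the Prop-1.1 clause at a real vector source, member `‖∇GJ‖`: `‖∇(G v)‖ ≤ γ₀⁻¹‖v‖` in pv15's real norms.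
[cite: Balaban1984PropagatorsI, Prop. 1.1 (1.89) p.33 (‖∇GJ‖ ≤ γ₀⁻¹‖J‖)] -/
theorem l2TR_gradR_GR_le_of_clause (hn : 1 ≤ n) {γ₀ : ℝ}
    (hcl : ∀ (m : Fin 6) (J : LocR n M), (latticeSettingP12R n M a k).l2op m J ≤ γ₀⁻¹ * (latticeSettingP12R n M a k).l2Norm J)
    (v : Bnd n M → ℝ) : l2TR (gradR n M (GR n M a *ᵥ v)) ≤ γ₀⁻¹ * l2R v := by
  have h := hcl 1 (LocR.vec v)
  change sqEta n d * l2op189 n M a 1 (Loc189.vec (cplx v)) ≤ γ₀⁻¹ * (sqEta n d * locNorm (Loc189.vec (cplx v))) at h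
  rw [B5Prop11SettingModel.l2op189_one_vec] at h
  change sqEta n d * l2T (grad n M ((B5DeltaA169.DeltaA n M a)⁻¹ *ᵥ cplx v)) ≤ γ₀⁻¹ * (sqEta n d * l2 (cplx v)) at h
  have e : l2T (grad n M ((B5DeltaA169.DeltaA n M a)⁻¹ *ᵥ cplx v)) = l2TR (gradR n M (GR n M a *ᵥ v)) := by
    rw [l2TR_eq, ← cplx_GR_mulVec n M a v]
    congr 1
    funext ν
    rw [cplx_gradR]
  rw [e, ← l2R_eq] at h
  have hs := sqEta_pos n hn (d := d)
  nlinarith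

/-- **THE FIELD `h89` OF `B5Local114.Realisation` FOR THE TORUS OF RECORD**: whenever the abstract Prop-1.1 clause of
`latticeSettingP12R n M a k` holds with a constant `γ₀`, then `‖G B‖ ≤ γ₀⁻¹‖B‖` and `‖Dg (G B)‖ ≤ γ₀⁻¹‖B‖` for EVERY `B` of the
graded carrier (slicewise (1.89), members ‖GJ‖ and ‖∇GJ‖). [cite: Balaban1984PropagatorsI, Prop. 1.1 (1.89) p.33] -/
theorem h89_holds (hn : 1 ≤ n) (γ₀ : ℝ) (hγ₀ : 0 < γ₀)
    (hcl : ∀ (m : Fin 6) (J : LocR n M), (latticeSettingP12R n M a k).l2op m J ≤ γ₀⁻¹ * (latticeSettingP12R n M a k).l2Norm J) :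
    (∀ B : Vsp n M, ‖Gop n M a B‖ ≤ γ₀⁻¹ * ‖B‖) ∧ (∀ B : Vsp n M, ‖Dg n M (Gop n M a B)‖ ≤ γ₀⁻¹ * ‖B‖) :=
  ⟨fun B => norm_kerOp_liftK_le n M (inv_pos.mpr hγ₀).le (l2R_GR_le_of_clause hn hcl) B,
   fun B => norm_Dg_kerOp_liftK_le n M (inv_pos.mpr hγ₀).le (l2TR_gradR_GR_le_of_clause hn hcl) B⟩

end H89

end

end Literature.MathematicalPhysics.QuantumFieldTheory.Balaban1983to89.B5WalkCarrierTorus
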